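import Mathlib
import Literature.NumberTheory.LFunctions.Zhang2022.SkeletonPartOne
import Literature.NumberTheory.LFunctions.Zhang2022.SkeletonPartOneB
import HarnessLib

/-!
# Zhang (2022) §4, first half (pp. 16–21, tex L878–L1125), STATEMENTS: the proof displays of
# Lemmas 4.1–4.4, the weight `g`/`ω₁` with (4.1)–(4.3), `Z̃` with (4.4)–(4.6), and the
# contour-shift programme (4.7)–(4.9) — every display typed as a named `Prop` over the skeleton

Topic `Literature/NumberTheory/LFunctions/Zhang2022` (Landau–Siegel audit tree; verdict-neutral).
Y. Zhang, *Discrete mean estimates and the Landau–Siegel zero*, arXiv:2211.02515v1 (2022)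
[Zhang2022LandauSiegel] — **an unrefereed manuscript under adjudication. Every `def … : Prop`
below is a CLAIM OF THE MANUSCRIPT (or the manuscript's own DEDUCTION of one display from the
inputs it cites), STATED NOT ASSERTED; nothing here asserts or denies Theorems 1–2.** Campaign
D-0069 (statements-first): this file refines the banked skeleton nodes `Skeleton.Lemma41`,
`Skeleton.Lemma42`, `Skeleton.Lemma43`, `Skeleton.Lemma44` (file `SkeletonPartOne`, which also owns
the objects `F = Skeleton.Fpoly`, `G = Skeleton.Gpoly`, `F(·,ψ̄) = Skeleton.FpolyBar`,
`LL = L(s,ψ)L(s,ψχ)`, `Z̃ = Skeleton.tildeZW`, `Ω₁, Ω₂, Ω₃`) and `Skeleton.gW` (= `g`, file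
`SkeletonPartOneB`) into the chain of displayed claims of §4 up to the end of the proof of
Lemma 4.4 — it does NOT restate those nodes. The second half of §4 (`𝒜`, `ℬ`, (4.10) =
`Skeleton.Eq410`, Lemmas 4.5–4.8) is the sibling seat's file. Standing assumption of §4 (p. 16):
"`ψ (mod p) ∈ Ψ₁`" — kept as the hypothesis `x ∈ Skeleton.PsiOne χ` exactly in the displays whose
printed justification invokes (3.4)–(3.6) or Lemmas 4.1–4.2; identities and pointwise bounds that
the text derives for every `ψ` are typed for every `x : Skeleton.Chr D`.

Conventions are the skeleton's (`HOME/skel/INTERFACE.md`): "`X ≪ Y`" ↦ `∃ C, ForAllLarge (… X ≤ C·Y)`;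
"`1 + O(e^{−πt})`", "`1 + o(1)`" multiplicatively; "`O(P^{−c})`" / "`ε = exp{−c𝓛¹⁰}`" with an
unspecified `c > 0` ↦ `∃ c > 0, ∃ C, …`; `(2πi)⁻¹∫_{(c)} h(w) dw` ↦ `(1/2π)∫_ℝ h(c+iv) dv` (the tree's
`GaussWeight.gWeight_eq_verticalIntegral` convention). DAG node ids (`plan/DAG.tsv`) are given as
`Z22:§4.uNNN` / `Z22:(4.k)` in each docstring.

| decl | DAG node | page | printed item |
|---|---|---|---|
| `F20Stieltjes`, `CpowBound`, `CpowDerivBound`, `F20Bound`, `G20Bound`, `Ded41` | u003–u005, Lem4.1.pf | 16 | proof of Lemma 4.1 |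
| `FGSubOneEq`, `FGSubOneBound`, `Ded42` | u007, u008, Lem4.2.pf | 17 | proof of Lemma 4.2 |
| `rad43`, `ShiftMemOmega1`, `FTwoSided88`, `IsFrakl`, `FraklExists`, `FraklReBound`, `LogDerivEqFraklDeriv`, `Ded43a`, `Ded43b` | u011–u014, Lem4.3.pf | 17 | proof of Lemma 4.3 |
| `omega1W`, `GContourDef`, `GInnerIntegralForm`, `GaussianLineIntegral`, `GLogGaussianForm`, `Eq41`, `GIncreasing`, `GBounds`, `Eq42`, `Eq43` | u015–u019, (4.1)–(4.3) | 17–18 | the weight `g` |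
| `Eq44`, `Region45`, `TildeZFormula`, `Eq45`, `Eq46` | (4.4), u021, u022, (4.5), (4.6) | 18–19 | `Z̃` |
| `perronIntegrand/Line/Contour`, `ResidueSplit`, `epsW`, `gSum`, `LineOneEval`, `GSumBound`, `GSumBound180`, `FELine`, `midSum`, `tailSum`, `f47/f48/f49`, `ThreeWaySplit`, `Eq47`, `Eq48`, `Eq49`, `Ded44` | u025–u029, (4.7)–(4.9), Lem4.4.pf | 19–20 | proof of Lemma 4.4, reduction |
| `Shift47`, `Contour47Bound`, `Ded47`, `eq47_of`; `Shift48`, `sStar`, `Line48Bound`, `MidSumPI`, `Ded48a`, `Ded48b`; `Shift49`, `Contour49Bound`, `Ded49`, `eq49_of` | u030–u037 | 20–21 | the three contour shifts |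

Kernel-checked here (EDGES, no analysis): `ded43_of`, `eq47_of`, `eq49_of`; and the DISCHARGES from
the tree's Aug-19 structural files `gContourDef_holds`, `eq41_holds`, `gBounds_holds`, `eq42_holds`,
`eq43_holds` (`Section4GaussianWeight`), `eq44_of_psiChiPrimitive` (`Section4TildeZ`),
`shiftMemOmega1_holds` (`Section4Lemma43`). Structural cores for the remaining displays already in
the tree (cited, not restated): `Section4PartialIntegration` (`Lemma41.sum_mul_cpow_eq_one`,
`norm_cpow_le`, `norm_deriv_cpow_le`, `norm_F20_le`, `norm_sum_Ioc_le`), `Section4Lemma43`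
(`Lemma43.norm_logDeriv_le` = "Lemma 4 of [15, Ch. 2]", Borel–Carathéodory, via the tree's
`Literature.Analysis.Complex.BorelCaratheodoryDeriv`), `Section4TildeZ` (`GammaFactor.tildeZ_eq`,
`abs_norm_tildeZ_sub_le`, `norm_logDeriv_tildeZ_add_log_le`).

## References

* Y. Zhang, arXiv:2211.02515v1 (2022), §4 pp. 16–21: Lemmas 4.1–4.4 with proofs, (4.1)–(4.9).
  [cite: Zhang2022LandauSiegel, §4 pp. 16–21]
* A. A. Karatsuba, *Basic Analytic Number Theory* (1993), Ch. 2 Lemma 4 (= "[15, Chapter 2]" of the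
  manuscript; Borel–Carathéodory) — in the tree as `Literature.Analysis.Complex.BorelCaratheodoryDeriv`.
  [cite: MontgomeryVaughan2007, Ch. 6, Lemma 6.2]
-/

noncomputable section

open Complex Real ComplexConjugate MeasureTheory

namespace Literature.NumberTheory.LFunctions.Zhang2022.Section4

open Skeleton

/-! ## Objects of §4 not already in the skeleton -/

/-- **`ω₁(w) = exp{w²/(4𝓛³⁰)}`** (§4 p. 18; DAG `Z22:§4.u016`) — the tree's `GaussWeight.omega1` at
`Λ = 𝓛³⁰`. [cite: Zhang2022LandauSiegel, §4 p. 18] -/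
def omega1W (D : ℕ) (w : ℂ) : ℂ := GaussWeight.omega1 (ell D ^ 30) w

/-- **`ε = exp{−c𝓛¹⁰}`** (§4 p. 19, proof of Lemma 4.4; DAG `Z22:§4.u027`), `c > 0` unspecified.
[cite: Zhang2022LandauSiegel, §4 p. 19] -/
def epsW (c : ℝ) (D : ℕ) : ℝ := Real.exp (-c * ell D ^ 10)

/-- The region of (4.5)–(4.6): "Assume that `|Re(s − s₀)| < 100`, `|Im(s − s₀)| < 𝓛₁ + 3`"
(§4 p. 18; DAG `Z22:§4.u021`). [cite: Zhang2022LandauSiegel, §4 p. 18] -/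
def Region45 (D : ℕ) : Set ℂ := {s | |(s - s0 D).re| < 100 ∧ |(s - s0 D).im| < ell1 D + 3}

/-- **`s* = 1 + α − s̄`** (§4 p. 20, after the display following (4.8); DAG `Z22:§4.u034`).
[cite: Zhang2022LandauSiegel, §4 p. 20] -/
def sStar (D : ℕ) (s : ℂ) : ℂ := 1 + (alpha D : ℂ) - conj s

/-- The radius "`|w| ≤ (200𝓛)⁻¹log 𝓛`" of the proof of Lemma 4.3 (§4 p. 17).
[cite: Zhang2022LandauSiegel, §4 p. 17] -/
def rad43 (D : ℕ) : ℝ := Real.log (ell D) / (200 * ell D)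

/-- The integrand of the smoothed Perron integrals of the proof of Lemma 4.4 (§4 p. 19):
`f(w)·P^{(9/5)w}·ω₁(w)/w`. [cite: Zhang2022LandauSiegel, §4 p. 19] -/
def perronIntegrand (D : ℕ) (f : ℂ → ℂ) (w : ℂ) : ℂ :=
  f w * (bigP D : ℂ) ^ ((9 / 5 : ℂ) * w) * omega1W D w / w

/-- **`(2πi)⁻¹∫_{(c)} f(w)P^{(9/5)w}ω₁(w) dw/w`** (§4 p. 19), as `(1/2π)∫_ℝ (…)(c + iv) dv`.
[cite: Zhang2022LandauSiegel, §4 p. 19] -/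
def perronLine (D : ℕ) (f : ℂ → ℂ) (c : ℝ) : ℂ :=
  (1 / (2 * π) : ℂ) * ∫ v : ℝ, perronIntegrand D f (c + v * I)

/-- The shifted contours of §4 p. 20: from the line `Re w = a` "we move the contour of integration to
the vertical segments `w = b + iv` with `|v| < V`, `w = a + iv` with `|v| ≥ V`, and to the two
connecting horizontal segments `w = u ± iV` with `u` between `a` and `b`" (`V = 𝓛²⁰`; `b = 10`, `−α`,
`−σ−10` for (4.7), (4.8), (4.9)); the integral `(2πi)⁻¹∫ f(w)P^{(9/5)w}ω₁(w)dw/w` over that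
contour, oriented upwards (DAG `Z22:§4.u030`–`u037`). [cite: Zhang2022LandauSiegel, §4 p. 20] -/
def perronContour (D : ℕ) (f : ℂ → ℂ) (a b V : ℝ) : ℂ :=
  (1 / (2 * π) : ℂ) * ((∫ v in Set.Iic (-V), perronIntegrand D f (a + v * I))
      + (∫ v in (-V)..V, perronIntegrand D f (b + v * I))
      + ∫ v in Set.Ioi V, perronIntegrand D f (a + v * I))
    + (1 / (2 * π * I) : ℂ) * ((∫ u in a..b, perronIntegrand D f (u - V * I))
      - ∫ u in a..b, perronIntegrand D f (u + V * I))

section WithCharacter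

variable {D : ℕ} [NeZero D] (χ : DirichletCharacter ℂ D) (x : Chr D)

/-- **`𝔩(s,w) := log(F(s+w,ψ)/F(s,ψ))`, "which vanishes at `w = 0`, is analytic in `w`"** (§4 p. 17;
DAG `Z22:§4.u012`): a branch `𝔩` of the logarithm of `F(s+w,ψ)/F(s,ψ)` on `|w| ≤ R` with `𝔩(0) = 0`.
[cite: Zhang2022LandauSiegel, §4 p. 17] -/
def IsFrakl (s : ℂ) (R : ℝ) (𝔩 : ℂ → ℂ) : Prop :=
  𝔩 0 = 0 ∧ DifferentiableOn ℂ 𝔩 (Metric.closedBall 0 R) ∧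
    ∀ w ∈ Metric.closedBall (0 : ℂ) R, Complex.exp (𝔩 w) = Fpoly χ x (s + w) / Fpoly χ x s

/-- "The second sum on the right side": **`Σ_{D⁴<n<P²} ν(n)ψ(n)n^{−s}g(P^{9/5}/n)`** (§4 p. 19;
DAG `Z22:§4.u026`). [cite: Zhang2022LandauSiegel, §4 p. 19] -/
def gSum (s : ℂ) : ℂ :=
  ∑ n ∈ Finset.Ioo (D ^ 4) ⌈bigP D ^ 2⌉₊,
    nu χ n * x.ψ (n : ZMod x.p) * (n : ℂ) ^ (-s) * (gW D (bigP D ^ (9 / 5 : ℝ) / (n : ℝ)) : ℂ)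

/-- The middle piece of "this sum is split into three sums according to `n ≤ D⁴`, `D⁴ < n ≤ P²` and
`P² < n`" (§4 p. 19): **`Σ_{D⁴<n≤P²} ν(n)ψ̄(n)n^{−z}`** (DAG `Z22:(4.8)`).
[cite: Zhang2022LandauSiegel, §4 p. 19] -/
def midSum (z : ℂ) : ℂ :=
  ∑ n ∈ Finset.Ioc (D ^ 4) ⌊bigP D ^ 2⌋₊, nu χ n * psiBarFn x n * (n : ℂ) ^ (-z)

/-- The tail piece **`Σ_{n>P²} ν(n)ψ̄(n)n^{−z}`** (§4 p. 19; DAG `Z22:(4.9)`); the first piece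
`Σ_{n≤D⁴} ν(n)ψ̄(n)n^{−z}` is `Skeleton.FpolyBar χ x z`. [cite: Zhang2022LandauSiegel, §4 p. 19] -/
def tailSum (z : ℂ) : ℂ :=
  ∑' n : ℕ, if bigP D ^ 2 < (n : ℝ) then nu χ n * psiBarFn x n * (n : ℂ) ^ (-z) else 0

/-- The integrand of (4.7): `w ↦ Z̃(s+w,ψ)F(1−s−w,ψ̄)` (§4 p. 19). [cite: Zhang2022LandauSiegel, §4 (4.7) p. 19] -/
def f47 (s : ℂ) : ℂ → ℂ := fun w => tildeZW χ x (s + w) * FpolyBar χ x (1 - s - w)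

/-- The integrand of (4.8): `w ↦ Z̃(s+w,ψ)Σ_{D⁴<n≤P²} ν(n)ψ̄(n)n^{−(1−s−w)}` (§4 p. 20).
[cite: Zhang2022LandauSiegel, §4 (4.8) p. 20] -/
def f48 (s : ℂ) : ℂ → ℂ := fun w => tildeZW χ x (s + w) * midSum χ x (1 - s - w)

/-- The integrand of (4.9): `w ↦ Z̃(s+w,ψ)Σ_{n>P²} ν(n)ψ̄(n)n^{−(1−s−w)}` (§4 p. 20).
[cite: Zhang2022LandauSiegel, §4 (4.9) p. 20] -/
def f49 (s : ℂ) : ℂ → ℂ := fun w => tildeZW χ x (s + w) * tailSum χ x (1 - s - w)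

end WithCharacter

/-! ## Lemma 4.1 (p. 16): the proof displays (refine `Skeleton.Lemma41`) -/

/-- **"By the Stieltjes integral we may write `F(s,ψ)²⁰ = 1 + ∫₁^{D⁸⁰} x^{s₀−s} d{X₁(x,ψ)}`"**
(§4 p. 16; DAG `Z22:§4.u003`). `X₁(x,ψ) = Σ_{n≤x} ν₂₀(n)ψ(n)n^{−s₀}` is a step function, so the
Riemann–Stieltjes integral over `[1, D⁸⁰]` is the finite sum over its jumps at `1 < n ≤ D⁸⁰` (the jump
at `n = 1` is the printed "`1 +`"); typed in that evaluated form. Its partial-integration (Abel) form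
is the tree's `Lemma41.sum_mul_cpow_eq_one`. CLAIM. [cite: Zhang2022LandauSiegel, §4 Lemma 4.1 (proof) p. 16] -/
def F20Stieltjes : Prop :=
  ∀ (D : ℕ) [NeZero D] (χ : DirichletCharacter ℂ D) (x : Chr D) (s : ℂ),
    Fpoly χ x s ^ 20 = 1 + ∑ n ∈ Finset.Ioc 1 (D ^ 80),
      nu20 χ n * x.ψ (n : ZMod x.p) * (n : ℂ) ^ (-s0 D) * (n : ℂ) ^ (s0 D - s)

/-- **"For `s ∈ Ω₁` and `1 ≤ x ≤ D⁸⁰` we have `|x^{s₀−s}| ≪ 𝓛`"** (§4 p. 16; DAG `Z22:§4.u004`,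
first half). Structural core: `Lemma41.norm_cpow_le` (`≤ 𝓛^{4/5}`). CLAIM.
[cite: Zhang2022LandauSiegel, §4 Lemma 4.1 (proof) p. 16] -/
def CpowBound : Prop :=
  ∃ C : ℝ, ForAllLarge fun D _ _ => ∀ s ∈ Omega1 D, ∀ y : ℝ, 1 ≤ y → y ≤ (D : ℝ) ^ 80 →
    ‖(y : ℂ) ^ (s0 D - s)‖ ≤ C * ell D

/-- **"… `|d/dx (x^{s₀−s})| ≪ x⁻¹𝓛⁴⁰⁶`"** (§4 p. 16; DAG `Z22:§4.u004`, second half). Structural core: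
`Lemma41.norm_deriv_cpow_le`. CLAIM. [cite: Zhang2022LandauSiegel, §4 Lemma 4.1 (proof) p. 16] -/
def CpowDerivBound : Prop :=
  ∃ C : ℝ, ForAllLarge fun D _ _ => ∀ s ∈ Omega1 D, ∀ y : ℝ, 1 ≤ y → y ≤ (D : ℝ) ^ 80 →
    ‖deriv (fun u : ℝ => (u : ℂ) ^ (s0 D - s)) y‖ ≤ C * y⁻¹ * ell D ^ 406

/-- **"Hence, by partial integration, `|F(s,ψ)|²⁰ ≪ 1 + 𝓛⁴⁰⁶(|X₁(D⁸⁰,ψ)| + ∫₁^{D⁸⁰} |X₁(x,ψ)|x⁻¹dx)`"**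
for `s ∈ Ω₁` (§4 p. 16; DAG `Z22:§4.u005`; any `ψ ∈ Ψ` — (3.4) is applied afterwards). Structural
core: `Lemma41.norm_F20_le`. CLAIM. [cite: Zhang2022LandauSiegel, §4 Lemma 4.1 (proof) p. 16] -/
def F20Bound : Prop :=
  ∃ C : ℝ, ForAllLarge fun D _ χ => ∀ x : Chr D, ∀ s ∈ Omega1 D,
    ‖Fpoly χ x s‖ ^ 20 ≤ C * (1 + ell D ^ 406 *
      (‖X1 χ x ((D : ℝ) ^ 80)‖ + ∫ y in (1 : ℝ)..(D : ℝ) ^ 80, ‖X1 χ x y‖ / y))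

/-- **"For `G(s,ψ)` an entirely analogous bound is valid"** (§4 p. 16): `|G(s,ψ)|²⁰ ≪ 1 +
𝓛⁴⁰⁶(|X₂(D⁸⁰,ψ)| + ∫₁^{D⁸⁰} |X₂(x,ψ)|x⁻¹dx)` for `s ∈ Ω₁` (`G²⁰ = Σ υ₂₀ψn^{−s}`, `X₂` of §3 p. 15).
CLAIM. [cite: Zhang2022LandauSiegel, §4 Lemma 4.1 (proof) p. 16] -/
def G20Bound : Prop :=
  ∃ C : ℝ, ForAllLarge fun D _ χ => ∀ x : Chr D, ∀ s ∈ Omega1 D,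
    ‖Gpoly χ x s‖ ^ 20 ≤ C * (1 + ell D ^ 406 *
      (‖X2 χ x ((D : ℝ) ^ 80)‖ + ∫ y in (1 : ℝ)..(D : ℝ) ^ 80, ‖X2 χ x y‖ / y))

/-- **The manuscript's proof of Lemma 4.1** (§4 p. 16; DAG `Z22:Lem4.1.pf`): "The result now follows
by (3.4)" — from the two twentieth-power bounds and `ψ ∈ Ψ₁` (i.e. (3.4): the bracket is `< 𝓛¹¹⁷¹`,
`(406 + 1171)/20 < 79`, `Lemma41.exponent_lemma41`) to `Skeleton.Lemma41`. CLAIM(proof).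
[cite: Zhang2022LandauSiegel, §4 Lemma 4.1 (proof) p. 16] -/
def Ded41 : Prop := F20Bound → G20Bound → Lemma41

/-! ## Lemma 4.2 (p. 17): the proof displays (refine `Skeleton.Lemma42`) -/

/-- **"`F(s,ψ)G(s,ψ) − 1 = Σ_{D⁴<n≤D⁸} ς(n)ψ(n)n^{−s} = ∫_{D⁴}^{D⁸} x^{s₀−s} d{X₄(x,ψ)}`"** (§4 p. 17;
DAG `Z22:§4.u007`): the identity (the Stieltjes form is the same finite sum written against the step
function `X₄`). CLAIM. [cite: Zhang2022LandauSiegel, §4 Lemma 4.2 (proof) p. 17] -/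
def FGSubOneEq : Prop :=
  ∀ (D : ℕ) [NeZero D] (χ : DirichletCharacter ℂ D) (x : Chr D) (s : ℂ),
    Fpoly χ x s * Gpoly χ x s - 1 =
      ∑ n ∈ Finset.Ioc (D ^ 4) (D ^ 8), sig χ n * x.ψ (n : ZMod x.p) * (n : ℂ) ^ (-s)

/-- **"Thus, similar to (4.2) [sic; the display of Lemma 4.1's proof], by partial integration we
obtain `F(s,ψ)G(s,ψ) − 1 ≪ 𝓛⁴⁰⁶(|X₄(D⁸,ψ)| + ∫_{D⁴}^{D⁸} |X₄(x,ψ)|x⁻¹dx)`"** for `s ∈ Ω₁` (§4 p. 17;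
DAG `Z22:§4.u008`). Structural core: `Lemma41.norm_sum_Ioc_le`. CLAIM.
[cite: Zhang2022LandauSiegel, §4 Lemma 4.2 (proof) p. 17] -/
def FGSubOneBound : Prop :=
  ∃ C : ℝ, ForAllLarge fun D _ χ => ∀ x : Chr D, ∀ s ∈ Omega1 D,
    ‖Fpoly χ x s * Gpoly χ x s - 1‖ ≤ C * ell D ^ 406 *
      (‖X4 χ x ((D : ℝ) ^ 8)‖ + ∫ y in (D : ℝ) ^ 4..(D : ℝ) ^ 8, ‖X4 χ x y‖ / y)

/-- **The manuscript's proof of Lemma 4.2** (§4 p. 17; DAG `Z22:Lem4.2.pf`): "the right side being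
`O(𝓛⁻²²⁷)` by (3.6)" (`406 − 633 = −227`). CLAIM(proof). [cite: Zhang2022LandauSiegel, §4 Lemma 4.2 (proof) p. 17] -/
def Ded42 : Prop := FGSubOneBound → Lemma42

/-! ## Lemma 4.3 (p. 17): the proof displays (refine `Skeleton.Lemma43`) -/

/-- **"Assume `|w| ≤ (200𝓛)⁻¹log 𝓛`, so that `s + w ∈ Ω₁`"** for `s ∈ Ω₂` (§4 p. 17; DAG
`Z22:Lem4.3.pf`). Structural core: `Lemma43.mem_Omega1_of_mem_Omega2` (needs `log 𝓛 ≥ 200`);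
discharged below (`shiftMemOmega1_holds`). CLAIM. [cite: Zhang2022LandauSiegel, §4 Lemma 4.3 (proof) p. 17] -/
def ShiftMemOmega1 : Prop :=
  ForAllLarge fun D _ _ => ∀ s ∈ Omega2 D, ∀ w : ℂ, ‖w‖ ≤ rad43 D → s + w ∈ Omega1 D

/-- **"By Lemma 4.1 and 4.2, `𝓛⁻⁸⁸ ≪ |F(s+w,ψ)| ≪ 𝓛⁸⁸`"** for `ψ ∈ Ψ₁`, `s ∈ Ω₂`,
`|w| ≤ (200𝓛)⁻¹log 𝓛` (§4 p. 17; DAG `Z22:§4.u011`). CLAIM.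
[cite: Zhang2022LandauSiegel, §4 Lemma 4.3 (proof) p. 17] -/
def FTwoSided88 : Prop :=
  ∃ C : ℝ, ForAllLarge fun D _ χ => ∀ x ∈ PsiOne χ, ∀ s ∈ Omega2 D, ∀ w : ℂ, ‖w‖ ≤ rad43 D →
    (ell D ^ 88)⁻¹ ≤ C * ‖Fpoly χ x (s + w)‖ ∧ ‖Fpoly χ x (s + w)‖ ≤ C * ell D ^ 88

/-- **"Thus the logarithm `𝔩(s,w) := log(F(s+w,ψ)/F(s,ψ))`, which vanishes at `w = 0`, is analytic
in `w`"** — existence of such a branch on `|w| ≤ (200𝓛)⁻¹log 𝓛` for `ψ ∈ Ψ₁`, `s ∈ Ω₂` (§4 p. 17;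
DAG `Z22:§4.u012`). CLAIM. [cite: Zhang2022LandauSiegel, §4 Lemma 4.3 (proof) p. 17] -/
def FraklExists : Prop :=
  ForAllLarge fun D _ χ => ∀ x ∈ PsiOne χ, ∀ s ∈ Omega2 D,
    ∃ 𝔩 : ℂ → ℂ, IsFrakl χ x s (rad43 D) 𝔩

/-- **"and it satisfies `Re{𝔩(s,w)} ≪ log 𝓛`"** on `|w| ≤ (200𝓛)⁻¹log 𝓛`, for any such branch
(§4 p. 17; DAG `Z22:§4.u013`; `Re 𝔩 = log|F(s+w)/F(s)|` is branch-independent). CLAIM.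
[cite: Zhang2022LandauSiegel, §4 Lemma 4.3 (proof) p. 17] -/
def FraklReBound : Prop :=
  ∃ C : ℝ, ForAllLarge fun D _ χ => ∀ x ∈ PsiOne χ, ∀ s ∈ Omega2 D, ∀ 𝔩 : ℂ → ℂ,
    IsFrakl χ x s (rad43 D) 𝔩 →
      ∀ w ∈ Metric.closedBall (0 : ℂ) (rad43 D), (𝔩 w).re ≤ C * Real.log (ell D)

/-- **"Since `F′/F(s,ψ) = ∂/∂w 𝔩(s,w)|_{w=0}`"** for any branch `𝔩` as above (§4 p. 17; DAG
`Z22:§4.u014`). CLAIM. [cite: Zhang2022LandauSiegel, §4 Lemma 4.3 (proof) p. 17] -/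
def LogDerivEqFraklDeriv : Prop :=
  ∀ (D : ℕ) [NeZero D] (χ : DirichletCharacter ℂ D) (x : Chr D) (s : ℂ) (R : ℝ) (𝔩 : ℂ → ℂ),
    0 < R → IsFrakl χ x s R 𝔩 → deriv (Fpoly χ x) s / Fpoly χ x s = deriv 𝔩 0

/-- **Proof of Lemma 4.3, first step** (§4 p. 17; DAG `Z22:Lem4.3.pf`): "By Lemma 4.1 and 4.2,
`𝓛⁻⁸⁸ ≪ |F(s+w,ψ)| ≪ 𝓛⁸⁸`" (via `s + w ∈ Ω₁`, `|F| ≪ 𝓛⁷⁹`, `|F⁻¹| ≤ |G|/(1 − O(𝓛⁻²²⁷))`).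
CLAIM(proof). [cite: Zhang2022LandauSiegel, §4 Lemma 4.3 (proof) p. 17] -/
def Ded43a : Prop := Lemma41 → Lemma42 → FTwoSided88

/-- **Proof of Lemma 4.3, second step** (§4 p. 17; DAG `Z22:Lem4.3.pf`): "the result follows by
Lemma 4 of [15, Chapter 2]" (Borel–Carathéodory for the derivative; the tree's
`Lemma43.norm_logDeriv_le` gives `|F′/F(s)| ≤ 800·88·𝓛` from the two-sided bound). CLAIM(proof).
[cite: Zhang2022LandauSiegel, §4 Lemma 4.3 (proof) p. 17] -/
def Ded43b : Prop := FTwoSided88 → Lemma43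

/-- The two steps compose to the section-level deduction "Lemmas 4.1, 4.2 ⊢ Lemma 4.3".
[cite: Zhang2022LandauSiegel, §4 Lemma 4.3 (proof) p. 17] -/
theorem ded43_of (ha : Ded43a) (hb : Ded43b) : Lemma41 → Lemma42 → Lemma43 :=
  fun h41 h42 => hb (ha h41 h42)

/-! ## The weight `g(x)` (pp. 17–18): (4.1)–(4.3) (object `Skeleton.gW`) -/

/-- **"Let `g(x) = (2πi)⁻¹∫_{(c)} x^w ω₁(w) dw/w` (`c > 0`)"** — the manuscript's DEFINITION of `g`
(§4 p. 17; DAG `Z22:§4.u015`), typed as the identity between that integral and the skeleton's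
`gW` (which is defined by the (4.1) form). Discharged below (`gContourDef_holds`, the tree's
`GaussWeight.gWeight_eq_verticalIntegral`). CLAIM. [cite: Zhang2022LandauSiegel, §4 p. 17] -/
def GContourDef : Prop :=
  ForAllLarge fun D _ _ => ∀ c : ℝ, 0 < c → ∀ y : ℝ, 0 < y →
    (1 / (2 * π) : ℂ) * ∫ v : ℝ, (y : ℂ) ^ ((c : ℂ) + v * I) * omega1W D (c + v * I) / (c + v * I)
      = (gW D y : ℂ)

/-- **"We may write `g(x) = (2πi)⁻¹∫_{(c)} (∫₀ˣ y^{w−1}dy) ω₁(w) dw`"** (§4 p. 18; DAG `Z22:§4.u017`).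
CLAIM. [cite: Zhang2022LandauSiegel, §4 p. 18] -/
def GInnerIntegralForm : Prop :=
  ForAllLarge fun D _ _ => ∀ c : ℝ, 0 < c → ∀ y : ℝ, 0 < y →
    (1 / (2 * π) : ℂ) * ∫ v : ℝ,
        (∫ u in (0 : ℝ)..y, (u : ℂ) ^ ((c : ℂ) + v * I - 1)) * omega1W D (c + v * I)
      = (gW D y : ℂ)

/-- **"Since `(2πi)⁻¹∫_{(c)} exp{(log y)w + w²/(4𝓛³⁰)} dw = (𝓛¹⁵/√π)exp{−𝓛³⁰(log y)²}`"**
(§4 p. 18; DAG `Z22:§4.u018`; `y > 0`). Structural core: `GaussWeight.integral_omega1_mul_exp`.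
CLAIM. [cite: Zhang2022LandauSiegel, §4 p. 18] -/
def GaussianLineIntegral : Prop :=
  ForAllLarge fun D _ _ => ∀ c : ℝ, 0 < c → ∀ y : ℝ, 0 < y →
    (1 / (2 * π) : ℂ) * ∫ v : ℝ,
        Complex.exp ((Real.log y : ℂ) * ((c : ℂ) + v * I) + ((c : ℂ) + v * I) ^ 2 / (4 * (ell D : ℂ) ^ 30))
      = ((ell D ^ 15 / Real.sqrt π * Real.exp (-(ell D ^ 30) * Real.log y ^ 2) : ℝ) : ℂ)

/-- **"it follows, by changing the order of integration, that
`g(x) = (𝓛¹⁵/√π)∫₀ˣ exp{−𝓛³⁰(log y)²} dy/y`"** (§4 p. 18; DAG `Z22:§4.u019`; `x > 0`). CLAIM.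
[cite: Zhang2022LandauSiegel, §4 p. 18] -/
def GLogGaussianForm : Prop :=
  ForAllLarge fun D _ _ => ∀ y : ℝ, 0 < y →
    gW D y = ell D ^ 15 / Real.sqrt π *
      ∫ u in (0 : ℝ)..y, Real.exp (-(ell D ^ 30) * Real.log u ^ 2) / u

/-- **(4.1)**: "by substituting `t = 𝓛¹⁵log y`, `g(x) = (1/√π)∫_{−∞}^{𝓛¹⁵log x} exp{−t²} dt`"
(§4 p. 18; DAG `Z22:(4.1)`; `x > 0`). Discharged below (`eq41_holds`, `GaussWeight.gWeight_eq_erf_form`).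
CLAIM. [cite: Zhang2022LandauSiegel, §4 (4.1) p. 18] -/
def Eq41 : Prop :=
  ForAllLarge fun D _ _ => ∀ y : ℝ, 0 < y →
    gW D y = 1 / Real.sqrt π * ∫ t in Set.Iic (ell D ^ 15 * Real.log y), Real.exp (-t ^ 2)

/-- **"Thus the function `g(x)` is increasing"** (§4 p. 18, after (4.1); on its domain `x > 0`).
CLAIM. [cite: Zhang2022LandauSiegel, §4 (4.1) p. 18] -/
def GIncreasing : Prop := ForAllLarge fun D _ _ => StrictMonoOn (gW D) (Set.Ioi 0)

/-- **"and it satisfies `0 < g(x) < 1`"** (§4 p. 18, after (4.1); `x > 0`). Discharged below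
(`gBounds_holds`). CLAIM. [cite: Zhang2022LandauSiegel, §4 (4.1) p. 18] -/
def GBounds : Prop := ForAllLarge fun D _ _ => ∀ y : ℝ, 0 < y → 0 < gW D y ∧ gW D y < 1

/-- **(4.2)**: "`g(x) = 1 + O(exp{−𝓛³⁰log²x})` if `x ≥ 1`" (§4 p. 18; DAG `Z22:(4.2)`). Discharged
below with the constant `1/2` (`eq42_holds`, `GaussWeight.abs_gWeight_sub_one_le`). CLAIM.
[cite: Zhang2022LandauSiegel, §4 (4.2) p. 18] -/
def Eq42 : Prop :=
  ∃ C : ℝ, ForAllLarge fun D _ _ => ∀ y : ℝ, 1 ≤ y →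
    |gW D y - 1| ≤ C * Real.exp (-(ell D ^ 30) * Real.log y ^ 2)

/-- **(4.3)**: "`g(x) = O(exp{−𝓛³⁰log²x})` if `x ≤ 1`" (§4 p. 18; DAG `Z22:(4.3)`; `0 < x ≤ 1`).
Discharged below (`eq43_holds`, `GaussWeight.gWeight_le`). CLAIM. [cite: Zhang2022LandauSiegel, §4 (4.3) p. 18] -/
def Eq43 : Prop :=
  ∃ C : ℝ, ForAllLarge fun D _ _ => ∀ y : ℝ, 0 < y → y ≤ 1 →
    |gW D y| ≤ C * Real.exp (-(ell D ^ 30) * Real.log y ^ 2)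

/-! ## `Z̃(s,ψ) = Z(s,ψ)Z(s,ψχ)` (pp. 18–19): (4.4)–(4.6) (object `Skeleton.tildeZW`) -/

/-- **(4.4)**: "`L(s,ψ)L(s,ψχ) = Z̃(s,ψ)L(1−s,ψ̄)L(1−s,χψ̄)`" (§4 p. 18; DAG `Z22:(4.4)`; preceded by
"`χψ` is a primitive character (mod `Dp`)" = `Skeleton.PsiChiPrimitive`). An identity of meromorphic
functions; typed off the real axis (`Im s ≠ 0`, where every factor is a genuine value — all uses have
`t ≈ 2πt₀`). `ψ̄ = ψ⁻¹`. Proved below from `Skeleton.PsiChiPrimitive` (`eq44_of_psiChiPrimitive`,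
`GammaFactor.LFunction_mul_LFunction_eq`). CLAIM. [cite: Zhang2022LandauSiegel, §4 (4.4) p. 18] -/
def Eq44 : Prop :=
  ForAllLarge fun D _ χ => ∀ x : Chr D, ∀ s : ℂ, s.im ≠ 0 →
    LL χ x s = tildeZW χ x s * ((x.ψ)⁻¹.LFunction (1 - s) * (psiChi χ x)⁻¹.LFunction (1 - s))

/-- **"By (2.4) with `θ = ψ` and `θ = ψχ` we have
`Z̃(s,ψ) = χ(−1)τ(ψ)τ(ψχ)(Dp²)^{−s}ϑ(s)²(1 + O(e^{−πt}))`"** on `|Re(s−s₀)| < 100`,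
`|Im(s−s₀)| < 𝓛₁ + 3` (§4 p. 18; DAG `Z22:§4.u022`; `τ` = `GammaFactor.tau`, `ϑ` = `GammaFactor.vartheta`
of (2.3)). Structural core: `GammaFactor.tildeZ_eq` + `norm_corr_le`. CLAIM.
[cite: Zhang2022LandauSiegel, §4 p. 18] -/
def TildeZFormula : Prop :=
  ∃ C : ℝ, ForAllLarge fun D _ χ => ∀ x : Chr D, ∀ s ∈ Region45 D,
    ‖tildeZW χ x s - χ (-1) * GammaFactor.tau x.ψ * GammaFactor.tau (psiChi χ x) *
        (((D : ℝ) * (x.p : ℝ) ^ 2 : ℝ) : ℂ) ^ (-s) * GammaFactor.vartheta s ^ 2‖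
      ≤ C * Real.exp (-π * s.im) *
        ‖χ (-1) * GammaFactor.tau x.ψ * GammaFactor.tau (psiChi χ x) *
          (((D : ℝ) * (x.p : ℝ) ^ 2 : ℝ) : ℂ) ^ (-s) * GammaFactor.vartheta s ^ 2‖

/-- **(4.5)**: "This yields, by Stirling's formula, `|Z̃(s,ψ)| = (Dp²t₀²)^{1/2−σ}(1 + o(1))`" on
`|Re(s−s₀)| < 100`, `|Im(s−s₀)| < 𝓛₁ + 3` (§4 p. 18; DAG `Z22:(4.5)`). Structural core:
`GammaFactor.abs_norm_tildeZ_sub_le`. CLAIM. [cite: Zhang2022LandauSiegel, §4 (4.5) p. 18] -/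
def Eq45 : Prop :=
  ∀ ε : ℝ, 0 < ε → ForAllLarge fun D _ χ => ∀ x : Chr D, ∀ s ∈ Region45 D,
    |‖tildeZW χ x s‖ - ((D : ℝ) * (x.p : ℝ) ^ 2 * t0 D ^ 2) ^ (1 / 2 - s.re)|
      ≤ ε * ((D : ℝ) * (x.p : ℝ) ^ 2 * t0 D ^ 2) ^ (1 / 2 - s.re)

/-- **(4.6)**: "`(Z̃′/Z̃)(s,ψ) = −2 log P + O(𝓛)`" on `|Re(s−s₀)| < 100`, `|Im(s−s₀)| < 𝓛₁ + 3`
(§4 p. 19; DAG `Z22:(4.6)`). Structural core: `GammaFactor.norm_logDeriv_tildeZ_add_log_le`. CLAIM.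
[cite: Zhang2022LandauSiegel, §4 (4.6) p. 19] -/
def Eq46 : Prop :=
  ∃ C : ℝ, ForAllLarge fun D _ χ => ∀ x : Chr D, ∀ s ∈ Region45 D,
    ‖deriv (tildeZW χ x) s / tildeZW χ x s + 2 * Real.log (bigP D)‖ ≤ C * ell D

/-! ## Lemma 4.4 (pp. 19–21): the proof displays (refine `Skeleton.Lemma44`) -/

/-- **"By the residue theorem, `L(s,ψ)L(s,ψχ) = (2πi)⁻¹(∫_{(1)} − ∫_{(−σ−1/2)})
L(s+w,ψ)L(s+w,ψχ)P^{(9/5)w} ω₁(w)dw/w`"** for `s ∈ Ω₃` (§4 p. 19; DAG `Z22:§4.u025`). CLAIM.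
[cite: Zhang2022LandauSiegel, §4 Lemma 4.4 (proof) p. 19] -/
def ResidueSplit : Prop :=
  ForAllLarge fun D _ χ => ∀ x : Chr D, ∀ s ∈ Omega3 D,
    LL χ x s = perronLine D (fun w => LL χ x (s + w)) 1
      - perronLine D (fun w => LL χ x (s + w)) (-s.re - 1 / 2)

/-- **"By (4.2) and (4.3), `(2πi)⁻¹∫_{(1)} L(s+w,ψ)L(s+w,ψχ)P^{(9/5)w}ω₁(w)dw/w
= F(s,ψ) + Σ_{D⁴<n<P²} ν(n)ψ(n)n^{−s}g(P^{9/5}/n) + O(ε)` where `ε = exp{−c𝓛¹⁰}`"** for `s ∈ Ω₃`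
(§4 p. 19; DAG `Z22:§4.u026`–`u027`). Structural core: `GaussWeight.integral_LSeries_mul_kernel`.
CLAIM. [cite: Zhang2022LandauSiegel, §4 Lemma 4.4 (proof) p. 19] -/
def LineOneEval : Prop :=
  ∃ c : ℝ, 0 < c ∧ ∃ C : ℝ, ForAllLarge fun D _ χ => ∀ x : Chr D, ∀ s ∈ Omega3 D,
    ‖perronLine D (fun w => LL χ x (s + w)) 1 - (Fpoly χ x s + gSum χ x s)‖ ≤ C * epsW c D

/-- **"By (3.5) and partial summation, the second sum … is
`= ∫_{D⁴}^{P²} g(P^{9/5}/x)x^{s₀−s}dX₃(x,ψ) ≪ 𝓛₁(|X₃(P²,ψ)| + ∫_{D⁴}^{P²}|X₃(x,ψ)|x⁻¹dx)`"** for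
`s ∈ Ω₃` (§4 p. 19; DAG `Z22:§4.u028`, first `≪`; any `ψ`). CLAIM.
[cite: Zhang2022LandauSiegel, §4 Lemma 4.4 (proof) p. 19] -/
def GSumBound : Prop :=
  ∃ C : ℝ, ForAllLarge fun D _ χ => ∀ x : Chr D, ∀ s ∈ Omega3 D,
    ‖gSum χ x s‖ ≤ C * ell1 D *
      (‖X3 χ x (bigP D ^ 2)‖ + ∫ y in (D : ℝ) ^ 4..bigP D ^ 2, ‖X3 χ x y‖ / y)

/-- **"… `≪ 𝓛⁻¹⁸⁰`"** — the second `≪` of the same display, by (3.5), for `ψ ∈ Ψ₁`, `s ∈ Ω₃`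
(§4 p. 19; DAG `Z22:§4.u028`; `405 − 585 = −180`). CLAIM. [cite: Zhang2022LandauSiegel, §4 Lemma 4.4 (proof) p. 19] -/
def GSumBound180 : Prop :=
  ∃ C : ℝ, ForAllLarge fun D _ χ => ∀ x ∈ PsiOne χ, ∀ s ∈ Omega3 D,
    ‖gSum χ x s‖ ≤ C * (ell D ^ 180)⁻¹

/-- **"On the other hand, by the functional equation, for `u = −σ − 1/2`,
`L(s+w,ψ)L(s+w,ψχ) = Z̃(s+w,ψ)Σₙ ν(n)ψ̄(n)n^{−(1−s−w)}`"** (`Re w = −σ − 1/2`, so the series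
converges absolutely; `s ∈ Ω₃`) (§4 p. 19; DAG `Z22:§4.u029`). CLAIM.
[cite: Zhang2022LandauSiegel, §4 Lemma 4.4 (proof) p. 19] -/
def FELine : Prop :=
  ForAllLarge fun D _ χ => ∀ x : Chr D, ∀ s ∈ Omega3 D, ∀ w : ℂ, w.re = -s.re - 1 / 2 →
    LL χ x (s + w) = tildeZW χ x (s + w) * LSeries (fun n => nu χ n * psiBarFn x n) (1 - s - w)

/-- **"This sum is split into three sums according to `n ≤ D⁴`, `D⁴ < n ≤ P²` and `P² < n`"** —
the integral on `Re w = −σ − 1/2` splits accordingly (§4 p. 19; the step between `Z22:§4.u029` and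
(4.7)–(4.9); it carries the interchange of the integral with the three-way split). CLAIM.
[cite: Zhang2022LandauSiegel, §4 Lemma 4.4 (proof) p. 19] -/
def ThreeWaySplit : Prop :=
  ForAllLarge fun D _ χ => ∀ x : Chr D, ∀ s ∈ Omega3 D,
    perronLine D (fun w => LL χ x (s + w)) (-s.re - 1 / 2)
      = perronLine D (f47 χ x s) (-s.re - 1 / 2) + perronLine D (f48 χ x s) (-s.re - 1 / 2)
        + perronLine D (f49 χ x s) (-s.re - 1 / 2)

/-- **(4.7)**: "`(2πi)⁻¹∫_{(−σ−1/2)} Z̃(s+w,ψ)F(1−s−w,ψ̄)P^{(9/5)w}ω₁(w)dw/w = −Z̃(s,ψ)F(1−s,ψ̄) + O(P^{−c})`"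
for `s ∈ Ω₃` (§4 p. 19; DAG `Z22:(4.7)`). CLAIM. [cite: Zhang2022LandauSiegel, §4 (4.7) p. 19] -/
def Eq47 : Prop :=
  ∃ c : ℝ, 0 < c ∧ ∃ C : ℝ, ForAllLarge fun D _ χ => ∀ x : Chr D, ∀ s ∈ Omega3 D,
    ‖perronLine D (f47 χ x s) (-s.re - 1 / 2) + tildeZW χ x s * FpolyBar χ x (1 - s)‖
      ≤ C * bigP D ^ (-c)

/-- **(4.8)**: "`(2πi)⁻¹∫_{(−σ−1/2)} Z̃(s+w,ψ)(Σ_{D⁴<n≤P²} ν(n)ψ̄(n)n^{−(1−s−w)})P^{(9/5)w}ω₁(w)dw/w ≪ 𝓛⁻¹⁷⁹`"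
for `ψ ∈ Ψ₁`, `s ∈ Ω₃` (§4 p. 20; DAG `Z22:(4.8)`; it uses (3.5)). CLAIM. [cite: Zhang2022LandauSiegel, §4 (4.8) p. 20] -/
def Eq48 : Prop :=
  ∃ C : ℝ, ForAllLarge fun D _ χ => ∀ x ∈ PsiOne χ, ∀ s ∈ Omega3 D,
    ‖perronLine D (f48 χ x s) (-s.re - 1 / 2)‖ ≤ C * (ell D ^ 179)⁻¹

/-- **(4.9)**: "`(2πi)⁻¹∫_{(−σ−1/2)} Z̃(s+w,ψ)(Σ_{n>P²} ν(n)ψ̄(n)n^{−(1−s−w)})P^{(9/5)w}ω₁(w)dw/w ≪ P^{−c}`"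
for `s ∈ Ω₃` (§4 p. 20; DAG `Z22:(4.9)`). CLAIM. [cite: Zhang2022LandauSiegel, §4 (4.9) p. 20] -/
def Eq49 : Prop :=
  ∃ c : ℝ, 0 < c ∧ ∃ C : ℝ, ForAllLarge fun D _ χ => ∀ x : Chr D, ∀ s ∈ Omega3 D,
    ‖perronLine D (f49 χ x s) (-s.re - 1 / 2)‖ ≤ C * bigP D ^ (-c)

/-- **The manuscript's proof of Lemma 4.4** (§4 pp. 19–20; DAG `Z22:Lem4.4.pf`): "The proof is
therefore reduced to showing (4.7), (4.8) and (4.9)" — from the residue split, the evaluation of the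
line `Re w = 1` (with the `𝓛⁻¹⁸⁰` bound for its sum and `ε`), the three-way split and (4.7)–(4.9) to
`Skeleton.Lemma44` (`𝓛⁻¹⁸⁰ + ε + 2P^{−c} + 𝓛⁻¹⁷⁹ = O(𝓛⁻¹⁷⁹)`). CLAIM(proof).
[cite: Zhang2022LandauSiegel, §4 Lemma 4.4 (proof) pp. 19–20] -/
def Ded44 : Prop :=
  ResidueSplit → LineOneEval → GSumBound180 → ThreeWaySplit → Eq47 → Eq48 → Eq49 → Lemma44

/-! ### (4.7): "we move the contour of integration …" (p. 20) -/

/-- **The contour shift for (4.7)** (§4 p. 20; DAG `Z22:§4.u030`–`u031`): moving `Re w = −σ−1/2` to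
"`w = 10 + iv` (`|v| < 𝓛²⁰`), `w = −σ−1/2 + iv` (`|v| ≥ 𝓛²⁰`), `w = u ± i𝓛²⁰` (`−σ−1/2 ≤ u ≤ 10`)"
crosses the simple pole of `ω₁(w)/w` at `w = 0` ("the residue theorem"), with residue
`Z̃(s,ψ)F(1−s,ψ̄)`. CLAIM. [cite: Zhang2022LandauSiegel, §4 (4.7) (proof) p. 20] -/
def Shift47 : Prop :=
  ForAllLarge fun D _ χ => ∀ x : Chr D, ∀ s ∈ Omega3 D,
    perronLine D (f47 χ x s) (-s.re - 1 / 2)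
      = perronContour D (f47 χ x s) (-s.re - 1 / 2) 10 (ell D ^ 20)
        - tildeZW χ x s * FpolyBar χ x (1 - s)

/-- **"By a trivial bound for `ω₁(w)`, (4.5) …"**: the shifted contour integral for (4.7) is
`O(P^{−c})`, `s ∈ Ω₃` (§4 p. 20). CLAIM. [cite: Zhang2022LandauSiegel, §4 (4.7) (proof) p. 20] -/
def Contour47Bound : Prop :=
  ∃ c : ℝ, 0 < c ∧ ∃ C : ℝ, ForAllLarge fun D _ χ => ∀ x : Chr D, ∀ s ∈ Omega3 D,
    ‖perronContour D (f47 χ x s) (-s.re - 1 / 2) 10 (ell D ^ 20)‖ ≤ C * bigP D ^ (-c)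

/-- **"By a trivial bound for `ω₁(w)`, (4.5) [we bound the shifted contour]"** as a deduction from
(4.5) (§4 p. 20; `|ω₁(u + iv)| = exp{(u² − v²)/(4𝓛³⁰)}`, `GaussWeight.norm_omega1`). CLAIM(proof).
[cite: Zhang2022LandauSiegel, §4 (4.7) (proof) p. 20] -/
def Ded47 : Prop := Eq45 → Contour47Bound

/-- **"… and the residue theorem we obtain (4.7)"** — kernel-checked: the shift identity and the
contour bound give (4.7) with the same `c`, `C`. [cite: Zhang2022LandauSiegel, §4 (4.7) (proof) p. 20] -/
theorem eq47_of (h1 : Shift47) (h2 : Contour47Bound) : Eq47 := by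
  obtain ⟨c, hc, C, h2⟩ := h2
  refine ⟨c, hc, C, (h1.and h2).mono ?_⟩
  intro D _ χ _ _ h x s hs
  obtain ⟨hshift, hbound⟩ := h
  rw [hshift x s hs, sub_add_cancel]
  exact hbound x s hs

/-! ### (4.8): the second contour and the partial-integration bound (p. 20) -/

/-- **The contour shift for (4.8)** (§4 p. 20; DAG `Z22:§4.u032`–`u033`): moving `Re w = −σ−1/2`
to "`w = −α + iv` (`|v| < 𝓛²⁰`), `w = −σ−1/2 + iv` (`|v| ≥ 𝓛²⁰`), `w = u ± i𝓛²⁰`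
(`−σ−1/2 ≤ u ≤ −α`)" — no pole is crossed (`−α < 0`). CLAIM.
[cite: Zhang2022LandauSiegel, §4 (4.8) (proof) p. 20] -/
def Shift48 : Prop :=
  ForAllLarge fun D _ χ => ∀ x : Chr D, ∀ s ∈ Omega3 D,
    perronLine D (f48 χ x s) (-s.re - 1 / 2)
      = perronContour D (f48 χ x s) (-s.re - 1 / 2) (-alpha D) (ell D ^ 20)

/-- **"By a trivial bound for `ω₁(w)` and (4.5) we see that the left side of (4.8) is
`≪ P^{1−2σ}∫_{−𝓛²⁰}^{𝓛²⁰} |Σ_{D⁴<n≤P²} ν(n)ψ(n)n^{−(s*+iv)}| dv/(α+iv) + ε` with `s* = 1 + α − s̄`"**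
(§4 p. 20; DAG `Z22:§4.u034`; the printed `dv/(α+iv)` inside a real majorant is typed as `dv/|α+iv|`;
`ε = exp{−c𝓛¹⁰}` as before). CLAIM. [cite: Zhang2022LandauSiegel, §4 (4.8) (proof) p. 20] -/
def Line48Bound : Prop :=
  ∃ c : ℝ, 0 < c ∧ ∃ C : ℝ, ForAllLarge fun D _ χ => ∀ x : Chr D, ∀ s ∈ Omega3 D,
    ‖perronLine D (f48 χ x s) (-s.re - 1 / 2)‖
      ≤ C * (bigP D ^ (1 - 2 * s.re) *
          (∫ v in (-(ell D ^ 20))..(ell D ^ 20),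
            ‖∑ n ∈ Finset.Ioc (D ^ 4) ⌊bigP D ^ 2⌋₊,
                nu χ n * x.ψ (n : ZMod x.p) * (n : ℂ) ^ (-(sStar D s + v * I))‖
              / ‖(alpha D : ℂ) + v * I‖) + epsW c D)

/-- **"By partial integration, `Σ_{D⁴<n≤P²} ν(n)ψ(n)n^{−(s*+iv)} = ∫_{D⁴}^{P²} x^{s₀−s*−iv}dX₃(x,ψ)
≪ P^{2σ−1}𝓛₁(|X₃(P²,ψ)| + ∫_{D⁴}^{P²}|X₃(x,ψ)|x⁻¹dx)` for `|v| ≤ 𝓛²⁰`"** (`s ∈ Ω₃`; §4 p. 20;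
DAG `Z22:§4.u035`). Structural core: `Lemma41.norm_sum_mul_cpow_le`. CLAIM.
[cite: Zhang2022LandauSiegel, §4 (4.8) (proof) p. 20] -/
def MidSumPI : Prop :=
  ∃ C : ℝ, ForAllLarge fun D _ χ => ∀ x : Chr D, ∀ s ∈ Omega3 D, ∀ v : ℝ, |v| ≤ ell D ^ 20 →
    ‖∑ n ∈ Finset.Ioc (D ^ 4) ⌊bigP D ^ 2⌋₊,
        nu χ n * x.ψ (n : ZMod x.p) * (n : ℂ) ^ (-(sStar D s + v * I))‖
      ≤ C * bigP D ^ (2 * s.re - 1) * ell1 D *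
        (‖X3 χ x (bigP D ^ 2)‖ + ∫ y in (D : ℝ) ^ 4..bigP D ^ 2, ‖X3 χ x y‖ / y)

/-- **(4.8), first deduction** (§4 p. 20): "By a trivial bound for `ω₁(w)` and (4.5) we see that the
left side of (4.8) is `≪ …`" — from the shift and (4.5) to the integral majorant. CLAIM(proof).
[cite: Zhang2022LandauSiegel, §4 (4.8) (proof) p. 20] -/
def Ded48a : Prop := Shift48 → Eq45 → Line48Bound

/-- **(4.8), second deduction** (§4 p. 20): "From this and (3.5) we obtain (4.8)" — the majorant,
the partial-integration bound and (3.5) (`ψ ∈ Ψ₁`: `405 − 585 = −180`;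
`∫_{−𝓛²⁰}^{𝓛²⁰} dv/|α+iv| ≪ log 𝓛`) give `≪ 𝓛⁻¹⁷⁹`. CLAIM(proof). [cite: Zhang2022LandauSiegel, §4 (4.8) (proof) p. 20] -/
def Ded48b : Prop := Line48Bound → MidSumPI → Eq48

/-! ### (4.9): the third contour (pp. 20–21) -/

/-- **The contour shift for (4.9)** (§4 pp. 20–21; DAG `Z22:§4.u036`–`u037`): moving `Re w = −σ−1/2`
to "`w = −σ−10 + iv` (`|v| < 𝓛²⁰`), `w = −σ−1/2 + iv` (`|v| ≥ 𝓛²⁰`), `w = u ± i𝓛²⁰`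
(`−σ−10 ≤ u ≤ −σ−1/2`)" — no pole is crossed. CLAIM. [cite: Zhang2022LandauSiegel, §4 (4.9) (proof) p. 20] -/
def Shift49 : Prop :=
  ForAllLarge fun D _ χ => ∀ x : Chr D, ∀ s ∈ Omega3 D,
    perronLine D (f49 χ x s) (-s.re - 1 / 2)
      = perronContour D (f49 χ x s) (-s.re - 1 / 2) (-s.re - 10) (ell D ^ 20)

/-- **"… and applying (4.5) and trivial bounds for `ω₁(w)` and the involved sum"**: the shifted
contour integral for (4.9) is `O(P^{−c})`, `s ∈ Ω₃` (§4 p. 21). CLAIM.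
[cite: Zhang2022LandauSiegel, §4 (4.9) (proof) p. 21] -/
def Contour49Bound : Prop :=
  ∃ c : ℝ, 0 < c ∧ ∃ C : ℝ, ForAllLarge fun D _ χ => ∀ x : Chr D, ∀ s ∈ Omega3 D,
    ‖perronContour D (f49 χ x s) (-s.re - 1 / 2) (-s.re - 10) (ell D ^ 20)‖ ≤ C * bigP D ^ (-c)

/-- **(4.9), deduction** (§4 p. 21): the contour bound from (4.5) and trivial bounds. CLAIM(proof).
[cite: Zhang2022LandauSiegel, §4 (4.9) (proof) p. 21] -/
def Ded49 : Prop := Eq45 → Contour49Bound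

/-- **"The estimate (4.9) follows by moving the contour …"** — kernel-checked: the shift identity and
the contour bound give (4.9). [cite: Zhang2022LandauSiegel, §4 (4.9) (proof) pp. 20–21] -/
theorem eq49_of (h1 : Shift49) (h2 : Contour49Bound) : Eq49 := by
  obtain ⟨c, hc, C, h2⟩ := h2
  refine ⟨c, hc, C, (h1.and h2).mono ?_⟩
  intro D _ χ _ _ h x s hs
  obtain ⟨hshift, hbound⟩ := h
  rw [hshift x s hs]
  exact hbound x s hs

/-! ## Discharges from the tree's structural files (no new analysis) -/

/-- `𝓛 = log D > 0` for `D ≥ 2`. [cite: Zhang2022LandauSiegel, §2 (2.1)] -/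
private theorem ell_pos_of_two_le {D : ℕ} (hD : 2 ≤ D) : 0 < ell D := by
  have hD' : (1 : ℝ) < D := by exact_mod_cast hD
  exact Real.log_pos hD'

/-- **The manuscript's definition of `g` HOLDS for the skeleton's `gW`** (the tree's
`GaussWeight.gWeight_eq_verticalIntegral`). [cite: Zhang2022LandauSiegel, §4 p. 17] -/
theorem gContourDef_holds : GContourDef := by
  refine ForAllLarge.of_le 2 fun D _ χ hD _ _ c hc y hy => ?_
  have hΛ : 0 < ell D ^ 30 := pow_pos (ell_pos_of_two_le hD) 30
  simpa only [omega1W, gW] using GaussWeight.gWeight_eq_verticalIntegral hΛ hc hy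

/-- `GContourDef` — `_holds` alias of `gContourDef_holds` above under the fact's exact name (appended
2026-08-28, D-0026 bookkeeping: the proof term is the existing theorem of this file; no statement,
definition or attribute is edited; no new named fact; the ledger's debt table listed the fact
unproved). [cite: Zhang2022LandauSiegel, §4 p. 17] -/
theorem _root_.Literature.NumberTheory.LFunctions.Zhang2022.Section4.GContourDef_holds :
    GContourDef :=
  _root_.Literature.NumberTheory.LFunctions.Zhang2022.Section4.gContourDef_holds

/-- **(4.1) HOLDS** (`GaussWeight.gWeight_eq_erf_form`, `√(𝓛³⁰) = 𝓛¹⁵`).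
[cite: Zhang2022LandauSiegel, §4 (4.1) p. 18] -/
theorem eq41_holds : Eq41 := by
  refine ForAllLarge.of_le 2 fun D _ χ hD _ _ y _ => ?_
  have hℓ : 0 < ell D := ell_pos_of_two_le hD
  have hΛ : 0 < ell D ^ 30 := pow_pos hℓ 30
  have hsq : Real.sqrt (ell D ^ 30) = ell D ^ 15 := by
    rw [show ell D ^ 30 = (ell D ^ 15) ^ 2 by ring, Real.sqrt_sq (pow_nonneg hℓ.le 15)]
  rw [gW, GaussWeight.gWeight_eq_erf_form hΛ y, hsq]

/-- `Eq41` — `_holds` alias of `eq41_holds` above under the fact's exact name (appended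
2026-08-28, D-0026 bookkeeping: the proof term is the existing theorem of this file; no statement,
definition or attribute is edited; no new named fact; the ledger's debt table listed the fact
unproved). [cite: Zhang2022LandauSiegel, §4 (4.1) p. 18] -/
theorem _root_.Literature.NumberTheory.LFunctions.Zhang2022.Section4.Eq41_holds : Eq41 :=
  _root_.Literature.NumberTheory.LFunctions.Zhang2022.Section4.eq41_holds

/-- **"`0 < g(x) < 1`" HOLDS** (`GaussWeight.gWeight_pos`, `gWeight_lt_one`).
[cite: Zhang2022LandauSiegel, §4 (4.1) p. 18] -/
theorem gBounds_holds : GBounds := by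
  refine ForAllLarge.of_le 2 fun D _ χ hD _ _ y _ => ?_
  have hΛ : 0 < ell D ^ 30 := pow_pos (ell_pos_of_two_le hD) 30
  exact ⟨GaussWeight.gWeight_pos hΛ y, GaussWeight.gWeight_lt_one hΛ y⟩

/-- `GBounds` — `_holds` alias of `gBounds_holds` above under the fact's exact name (appended
2026-08-28, D-0026 bookkeeping: the proof term is the existing theorem of this file; no statement,
definition or attribute is edited; no new named fact; the ledger's debt table listed the fact
unproved). [cite: Zhang2022LandauSiegel, §4 (4.1) p. 18] -/
theorem _root_.Literature.NumberTheory.LFunctions.Zhang2022.Section4.GBounds_holds : GBounds :=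
  _root_.Literature.NumberTheory.LFunctions.Zhang2022.Section4.gBounds_holds

/-- **(4.2) HOLDS with the constant `1/2`** (`GaussWeight.abs_gWeight_sub_one_le`).
[cite: Zhang2022LandauSiegel, §4 (4.2) p. 18] -/
theorem eq42_holds : Eq42 := by
  refine ⟨1 / 2, ForAllLarge.of_le 2 fun D _ χ hD _ _ y hy => ?_⟩
  have hΛ : 0 < ell D ^ 30 := pow_pos (ell_pos_of_two_le hD) 30
  simpa only [gW] using GaussWeight.abs_gWeight_sub_one_le hΛ hy

/-- `Eq42` — `_holds` alias of `eq42_holds` above under the fact's exact name (appended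
2026-08-28, D-0026 bookkeeping: the proof term is the existing theorem of this file; no statement,
definition or attribute is edited; no new named fact; the ledger's debt table listed the fact
unproved). [cite: Zhang2022LandauSiegel, §4 (4.2) p. 18] -/
theorem _root_.Literature.NumberTheory.LFunctions.Zhang2022.Section4.Eq42_holds : Eq42 :=
  _root_.Literature.NumberTheory.LFunctions.Zhang2022.Section4.eq42_holds

/-- **(4.3) HOLDS with the constant `1/2`** (`GaussWeight.gWeight_le`, `gWeight_pos`).
[cite: Zhang2022LandauSiegel, §4 (4.3) p. 18] -/
theorem eq43_holds : Eq43 := by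
  refine ⟨1 / 2, ForAllLarge.of_le 2 fun D _ χ hD _ _ y hy hy1 => ?_⟩
  have hΛ : 0 < ell D ^ 30 := pow_pos (ell_pos_of_two_le hD) 30
  have h0 : 0 < gW D y := GaussWeight.gWeight_pos hΛ y
  rw [abs_of_pos h0]
  simpa only [gW] using GaussWeight.gWeight_le hΛ hy hy1

/-- `Eq43` — `_holds` alias of `eq43_holds` above under the fact's exact name (appended
2026-08-28, D-0026 bookkeeping: the proof term is the existing theorem of this file; no statement,
definition or attribute is edited; no new named fact; the ledger's debt table listed the fact
unproved). [cite: Zhang2022LandauSiegel, §4 (4.3) p. 18] -/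
theorem _root_.Literature.NumberTheory.LFunctions.Zhang2022.Section4.Eq43_holds : Eq43 :=
  _root_.Literature.NumberTheory.LFunctions.Zhang2022.Section4.eq43_holds

/-- **(4.4) HOLDS given `Skeleton.PsiChiPrimitive`** (which `SkeletonAssembly.psiChiPrimitive_holds`
proves; kept as a hypothesis here only to keep this file's imports light): the tree's
`GammaFactor.LFunction_mul_LFunction_eq`. [cite: Zhang2022LandauSiegel, §4 (4.4) p. 18] -/
theorem eq44_of_psiChiPrimitive (h : PsiChiPrimitive) : Eq44 := by
  refine ForAllLarge.of_le 3 fun D _ χ hD _ hχ x s hs => ?_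
  have hpc : (psiChi χ x).IsPrimitive := h D χ x hD hχ
  have hp1 : x.p ≠ 1 := x.p_ne_one
  have hDp : D * x.p ≠ 1 := by
    intro h1
    exact hp1 (Nat.eq_one_of_mul_eq_one_left h1)
  simpa only [LL, tildeZW] using
    GammaFactor.LFunction_mul_LFunction_eq x.prim hp1 hpc hDp hs

/-- `𝓛 > 0` and `log 𝓛 ≥ 200` once `D ≥ ⌈exp(exp 200)⌉` (one of the manuscript's effective
"`D` sufficiently large" thresholds). [cite: Zhang2022LandauSiegel, §2 p. 4] -/
private theorem ell_pos_and_loglog_ge {D : ℕ} (hD : ⌈Real.exp (Real.exp 200)⌉₊ ≤ D) :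
    0 < ell D ∧ 200 ≤ Real.log (ell D) := by
  have h1 : Real.exp (Real.exp 200) ≤ D := le_trans (Nat.le_ceil _) (by exact_mod_cast hD)
  have hDpos : (0 : ℝ) < D := lt_of_lt_of_le (Real.exp_pos _) h1
  have h2 : Real.exp 200 ≤ ell D := by
    rw [ell, Real.le_log_iff_exp_le hDpos]; exact h1
  have hℓpos : 0 < ell D := lt_of_lt_of_le (Real.exp_pos _) h2
  refine ⟨hℓpos, ?_⟩
  rw [Real.le_log_iff_exp_le hℓpos]; exact h2

/-- **"Assume `|w| ≤ (200𝓛)⁻¹log 𝓛`, so that `s + w ∈ Ω₁`" HOLDS** for `D ≥ exp(exp 200)`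
(`Lemma43.mem_Omega1_of_mem_Omega2`). [cite: Zhang2022LandauSiegel, §4 Lemma 4.3 (proof) p. 17] -/
theorem shiftMemOmega1_holds : ShiftMemOmega1 := by
  refine ForAllLarge.of_le ⌈Real.exp (Real.exp 200)⌉₊ fun D _ χ hD _ _ s hs w hw => ?_
  obtain ⟨hℓ, hlog⟩ := ell_pos_and_loglog_ge hD
  have hsmall : Real.log (ell D) / (200 * ell D) ≤ 1 := by
    rw [div_le_one (by positivity)]
    have := Real.log_le_sub_one_of_pos hℓ
    linarith
  exact Lemma43.mem_Omega1_of_mem_Omega2 hℓ hlog hsmall hs hw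

/-- `ShiftMemOmega1` — `_holds` alias of `shiftMemOmega1_holds` above under the fact's exact name (appended
2026-08-28, D-0026 bookkeeping: the proof term is the existing theorem of this file; no statement,
definition or attribute is edited; no new named fact; the ledger's debt table listed the fact
unproved). [cite: Zhang2022LandauSiegel, §4 Lemma 4.3 (proof) p. 17] -/
theorem _root_.Literature.NumberTheory.LFunctions.Zhang2022.Section4.ShiftMemOmega1_holds :
    ShiftMemOmega1 :=
  _root_.Literature.NumberTheory.LFunctions.Zhang2022.Section4.shiftMemOmega1_holds

end Literature.NumberTheory.LFunctions.Zhang2022.Section4
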